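import Mathlib
import Summits.ABC.ABC.Theses.RibetTakahashiSplit

/-!
# Glue C of route `RibetTakahashiSplit`: valuation product ⇒ sub-exponential abc

Item `stmt-ABC-11013` (`SubexpOfValuationProduct`, support, rank 9). If for every `ε > 0` the
valuation product `∏_{p ∣ abc} v_p(abc)` of an abc triple is `≤ K_ε · rad(abc)^ε`, then for every
`ε > 0` there is `κ_ε` with `log c ≤ κ_ε · rad(abc)^ε` for all abc triples.

Proof (elementary): for `n = abc ≠ 0` and `M = ∏_{p ∣ n} v_p(n)` every exponent `v_p(n)` is
`≤ M` (all factors are `≥ 1`), so `c ≤ n = ∏ p^{v_p(n)} ≤ (∏ p)^M = rad(n)^M`, whence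
`log c ≤ M · log rad ≤ K_{ε/2} rad^{ε/2} · log rad ≤ K_{ε/2} rad^{ε/2} · rad^{ε/2} / (ε/2)`
(`Real.log_le_rpow_div`), i.e. `κ_ε := K_{ε/2} / (ε/2)`.
-/

-- `Summit.<Summit>.<Problem>` is the mandated summit-side namespace (CONVENTIONS §2); for the
-- single-conjunct summit `ABC` the two coincide, so the duplicate `ABC.ABC` is deliberate.
set_option linter.dupNamespace false

namespace Summit.ABC.ABC.Theorems

open Literature.NumberTheory.DiophantineGeometry

/-- For `n ≠ 0` with `M = ∏_{p ∣ n} v_p(n)`: `n ≤ rad(n) ^ M`, because every exponent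
`v_p(n)` (`p ∣ n`) is at most the product `M` of all of them (each factor is `≥ 1`). -/
theorem le_radical_pow_prod_factorization {n : ℕ} (hn : n ≠ 0) :
    n ≤ UniqueFactorizationMonoid.radical n ^ ∏ p ∈ n.primeFactors, n.factorization p := by
  have hone : ∀ p ∈ n.primeFactors, 1 ≤ n.factorization p := fun p hp => by
    have h := Nat.mem_primeFactors.mp hp
    exact h.1.factorization_pos_of_dvd h.2.2 h.2.1
  have hle : ∀ p ∈ n.primeFactors, n.factorization p ≤ ∏ q ∈ n.primeFactors, n.factorization q :=
    fun p hp => Finset.single_le_prod' hone hp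
  calc n = ∏ p ∈ n.primeFactors, p ^ n.factorization p := by
        conv_lhs => rw [← Nat.prod_factorization_pow_eq_self hn]
        rw [Finsupp.prod, Nat.support_factorization]
    _ ≤ ∏ p ∈ n.primeFactors, p ^ ∏ q ∈ n.primeFactors, n.factorization q :=
        Finset.prod_le_prod' fun p hp =>
          Nat.pow_le_pow_right (Nat.pos_of_mem_primeFactors hp) (hle p hp)
    _ = UniqueFactorizationMonoid.radical n ^ ∏ q ∈ n.primeFactors, n.factorization q := by
        rw [Finset.prod_pow, Nat.radical_eq_prod_primeFactors]

/-- **Glue C** (item `stmt-ABC-11013`): the valuation-product bound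
`∏_{p ∣ abc} v_p(abc) ≤ K_ε rad(abc)^ε` (all `ε > 0`) implies sub-exponential abc
`log c ≤ κ_ε rad(abc)^ε` (all `ε > 0`), with `κ_ε = K_{ε/2} / (ε/2)`. -/
theorem subexpOfValuationProduct_proof :
    Summit.ABC.ABC.Theses.RibetTakahashiSplit.SubexpOfValuationProduct := by
  intro hVP ε hε
  obtain ⟨K, hK⟩ := hVP (ε / 2) (half_pos hε)
  refine ⟨K / (ε / 2), fun a b c habc => ?_⟩
  have hKabc := hK a b c habc
  obtain ⟨ha, hb, hsum, -⟩ := habc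
  have hc0 : 0 < c := by omega
  have hn0 : a * b * c ≠ 0 := Nat.mul_ne_zero (Nat.mul_ne_zero ha.ne' hb.ne') hc0.ne'
  rw [rad_def] at hKabc ⊢
  set n : ℕ := a * b * c
  set M : ℕ := ∏ p ∈ n.primeFactors, n.factorization p
  have hcn : c ≤ n := Nat.le_mul_of_pos_left c (Nat.mul_pos ha hb)
  have key : c ≤ UniqueFactorizationMonoid.radical n ^ M :=
    hcn.trans (le_radical_pow_prod_factorization hn0)
  have hR1 : (1 : ℝ) ≤ ((UniqueFactorizationMonoid.radical n : ℕ) : ℝ) := by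
    exact_mod_cast Nat.radical_pos n
  have hcR : (c : ℝ) ≤ ((UniqueFactorizationMonoid.radical n : ℕ) : ℝ) ^ M := by
    exact_mod_cast key
  set R : ℝ := ((UniqueFactorizationMonoid.radical n : ℕ) : ℝ)
  have hR0 : (0 : ℝ) < R := one_pos.trans_le hR1
  have hlogR : 0 ≤ Real.log R := Real.log_nonneg hR1
  have hM0 : (0 : ℝ) ≤ (M : ℝ) := Nat.cast_nonneg M
  have hKR : 0 ≤ K * R ^ (ε / 2) := hM0.trans hKabc
  have h1 : Real.log c ≤ (M : ℝ) * Real.log R :=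
    calc Real.log c ≤ Real.log (R ^ M) := Real.log_le_log (by exact_mod_cast hc0) hcR
      _ = (M : ℝ) * Real.log R := Real.log_pow R M
  have h2 : Real.log R ≤ R ^ (ε / 2) / (ε / 2) := Real.log_le_rpow_div hR0.le (half_pos hε)
  calc Real.log c ≤ (M : ℝ) * Real.log R := h1
    _ ≤ K * R ^ (ε / 2) * Real.log R := mul_le_mul_of_nonneg_right hKabc hlogR
    _ ≤ K * R ^ (ε / 2) * (R ^ (ε / 2) / (ε / 2)) := mul_le_mul_of_nonneg_left h2 hKR
    _ = K / (ε / 2) * (R ^ (ε / 2) * R ^ (ε / 2)) := by ring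
    _ = K / (ε / 2) * R ^ ε := by rw [← Real.rpow_add hR0, add_halves]

end Summit.ABC.ABC.Theorems
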